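import Literature.NumberTheory.EllipticCurves.AnticyclotomicSignedLayerZeroControl
import Literature.NumberTheory.EllipticCurves.SubgroupSelmerCocycleCriteriaProofs
import HarnessLib

/-!
# The signed condition at the base layer vs the Kummer condition — PROVED companions of the named fact
# `AcSigned.hatleyLeiVigni2022_lemma37_local_signedCondition_eq_kummer`

Topic `Literature/NumberTheory/EllipticCurves`; namespace `Literature.NumberTheory.EllipticCurves.AcSigned`
(sibling of `AnticyclotomicSignedLayerZeroControl.lean`, whose module docstring has the sources, the
reading and the consumer). PROVED theorems only (no definition, no named fact, no `sorry`, no instance):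
1. `kummer_le_condAboveTorsion_sgn_zero` — for every number field `K`, curve `W/K`, `ℤ_p`-extension `κ`,
   prime `v`, sign `ε` and `m`: the classical Kummer condition at the places above `v` ("every
   `Γ_K`-conjugate dies in `H¹(Gal(K̄_v/K_v), E(K̄_v))`", the `v`-component of
   `WeierstrassCurve.selmerTorsionOver`) IMPLIES the layer-`0` signed condition
   `condAboveTorsion W p κ v (sgn ε) 0 m` — Hatley–Lei–Vigni, proof of Lemma 3.7: "`E(K_v)/p^m E(K_v)`
   is contained in `ℋ^±_{0,v}[p^m]`" (no trace condition at the bottom layer), UNCONDITIONALLY on the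
   tree's carriers. So the content of the named fact is the reverse inclusion.
2. `lemma37_signedSelmerTorsion_zero_of_local` — the local identity implies the tree's GLOBAL fact
   `hatleyLeiVigni2022_lemma37_signedSelmerTorsion_zero` (`Sel^±_{p^m}(E/K) = Sel_{p^m}(E/K)`): both
   groups are the intersection of the same away-from-`p` conditions (`awayTorsionOver`) with the
   respective conditions above `p` — the printed reduction "In light of Remark 3.1, it suffices to show
   that `ℋ^±_{0,v}[p^m]` coincides with the image of `E(K_v)/p^m E(K_v)`".
3. `condAboveTorsion_sgn_zero_eq_of_local` — under the local identity the layer-`0` condition does not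
   depend on the sign.
BSD is not advanced by this file. [cite: HatleyLeiVigni2022, Lemma 3.7 (proof), Remark 3.1, Def. 3.4]
-/

noncomputable section

open scoped Classical

open NumberField IsDedekindDomain Field
open Literature.NumberTheory.EllipticCurves Literature.NumberTheory.GaloisRepresentations
open Literature.NumberTheory.EllipticCurves.Kobayashi2003
open Literature.NumberTheory.EllipticCurves.CocycleCriteria
open WeierstrassCurve (geomTorsion)

universe u

namespace Literature.NumberTheory.EllipticCurves.AcSigned

/-! ## Part 1. The easy inclusion: Kummer at the places above `v` ⟹ signed at layer `0` (proved) -/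

section Easy

variable {K : Type u} [Field K] [NumberField K] (W : WeierstrassCurve K) (p : ℕ) [Fact p.Prime]
  (κ : ZpExtension K p)

/-- **`E(K_v)/p^m E(K_v) ⊆ ℋ^±_{0,v}[p^m]`, on the tree's carriers (the EASY inclusion of the proof of
Hatley–Lei–Vigni's Lemma 3.7, unconditional).** For `c ∈ H¹(K_0, E[p^m])` (`K_0 = K`): if every
`Γ_K`-conjugate of `c` dies in `H¹(Gal(K̄_v/K_v), E(K̄_v))` at the chosen place above `v` (the
classical Kummer condition at the places above `v`, the `v`-component of
`WeierstrassCurve.selmerTorsionOver`), then `c ∈ condAboveTorsion W p κ v (sgn ε) 0 m` for BOTH signs.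
Proof: a cocycle `ψ` of `c` with `ψ(τ|_{K̄}) = τ a − a` on `Γ_{K_v}` (`a ∈ E(K̄_v)`); `θ_{0,m} c` is
represented by the same cocycle on `Gal(K̄/K_∞)`, its conjugates by `σ ∈ Γ_K = Γ_{K_0}` are itself
(inner automorphisms, `conjH1_of_mem_holds`), and on `Gal(K̄_v/K_∞·K_v)` it is the Kummer cocycle of
`a` with `p^m • a ∈ E(K_v) = E(K_0·K_v) ≤ E^ε(K_∞·K_v)` (no trace condition at the bottom layer,
`localLayerPointsOfEmb_zero_le_signedLocalPointsInfty`). Printed: "`E(K_v)/p^m E(K_v)` is contained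
in `ℋ^±_{0,v}[p^m]`, as explained in the proof of [Kim07]".
[cite: HatleyLeiVigni2022, Lemma 3.7 (proof), (3.1), Remark 3.1, Def. 3.4] -/
theorem kummer_le_condAboveTorsion_sgn_zero (v : HeightOneSpectrum (𝓞 K)) (ε : ℤˣ) (m : ℕ) :
    (⨅ σ : absoluteGaloisGroup K,
      ((W.localResTorsionOverOfEmb ((p : ℤ) ^ m) (κ.layerSubgroup 0)
          (closureEmb (K := K) (v.adicCompletion K))).ker).comap
        (conjH1 (κ.layerSubgroup 0) (geomTorsion W ((p : ℤ) ^ m)) σ)) ≤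
      condAboveTorsion W p κ v (.sgn ε) 0 m := by
  intro c hc
  -- conjugation by `σ ∈ Γ_K = Γ_{K_0}` is the identity on `H¹(Γ_{K_0}, ·)`
  have hconj : ∀ σ : absoluteGaloisGroup K,
      conjH1 (κ.layerSubgroup 0) (geomTorsion W ((p : ℤ) ^ m)) σ = AddMonoidHom.id _ := fun σ ↦
    conjH1_of_mem_holds (κ.layerSubgroup 0) (geomTorsion W ((p : ℤ) ^ m))
      (by rw [ZpExtension.layerSubgroup_zero]; exact Subgroup.mem_top σ)
  have h1 : W.localResTorsionOverOfEmb ((p : ℤ) ^ m) (κ.layerSubgroup 0)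
      (closureEmb (K := K) (v.adicCompletion K)) c = 0 := by
    have h := (AddSubgroup.mem_iInf.mp hc) 1
    rwa [AddSubgroup.mem_comap, hconj 1, AddMonoidHom.id_apply, AddMonoidHom.mem_ker] at h
  obtain ⟨ψ, rfl⟩ := oneCocycleClass_surjective
    (discreteTopRep (κ.layerSubgroup 0) (geomTorsion W ((p : ℤ) ^ m))) c
  -- the Kummer condition at the chosen place: `ψ(τ|_{K̄}) = τ a − a` on `Γ_{K_v}`
  have h2 := h1
  simp only [WeierstrassCurve.localResTorsionOverOfEmb] at h2
  rw [resH1Hom_oneCocycleClass_eq_zero_iff] at h2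
  obtain ⟨a, ha⟩ := h2
  -- every `τ ∈ Γ_{K_v}` lies in the local subgroup attached to `κ.layerSubgroup 0 = Γ_K`
  have hmem : ∀ τ : absoluteGaloisGroup (v.adicCompletion K),
      τ ∈ localSubgroupOfEmb (κ.layerSubgroup 0) (closureEmb (K := K) (v.adicCompletion K)) := fun τ ↦ by
    rw [mem_localSubgroupOfEmb_iff, ZpExtension.layerSubgroup_zero]; exact Subgroup.mem_top _
  have ha' : ∀ τ : absoluteGaloisGroup (v.adicCompletion K),
      pointsMapOfEmb W (closureEmb (K := K) (v.adicCompletion K))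
          ((ψ.1 ⟨resGalOfEmb (closureEmb (K := K) (v.adicCompletion K)) τ,
            by rw [ZpExtension.layerSubgroup_zero]; exact Subgroup.mem_top _⟩ :
              geomTorsion W ((p : ℤ) ^ m)) : W.geomPoints) = τ • a - a := fun τ ↦ ha ⟨τ, hmem τ⟩
  -- `p^m • (τ a − a) = 0`, so `p^m • a` is fixed by all of `Γ_{K_v}`
  have hfix : ∀ τ : absoluteGaloisGroup (v.adicCompletion K), τ • ((p ^ m) • a) = (p ^ m) • a := by
    intro τ
    have h1' : τ • a = a + pointsMapOfEmb W (closureEmb (K := K) (v.adicCompletion K))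
        ((ψ.1 ⟨resGalOfEmb (closureEmb (K := K) (v.adicCompletion K)) τ,
          by rw [ZpExtension.layerSubgroup_zero]; exact Subgroup.mem_top _⟩ :
            geomTorsion W ((p : ℤ) ^ m)) : W.geomPoints) := by
      rw [add_comm, ← sub_eq_iff_eq_add]; exact (ha' τ).symm
    have h0 : (p ^ m) • pointsMapOfEmb W (closureEmb (K := K) (v.adicCompletion K))
        ((ψ.1 ⟨resGalOfEmb (closureEmb (K := K) (v.adicCompletion K)) τ,
          by rw [ZpExtension.layerSubgroup_zero]; exact Subgroup.mem_top _⟩ :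
            geomTorsion W ((p : ℤ) ^ m)) : W.geomPoints) = 0 := by
      rw [← map_nsmul, ← natCast_zsmul, Nat.cast_pow,
        (WeierstrassCurve.mem_geomTorsion_iff W _ _).mp (ψ.1 _ : geomTorsion W ((p : ℤ) ^ m)).2, map_zero]
    rw [smul_comm, h1', nsmul_add, h0, add_zero]
  rw [mem_condAboveTorsion_iff, mem_condAbove_sgn_iff]
  intro σ
  rw [← toInfty_conjH1, hconj σ, AddMonoidHom.id_apply]
  simp only [toInfty]
  change (ContinuousCohomology.map (subgroupInclusion (κ.kerSubgroup_le_layerSubgroup 0))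
      (resHomOfEquivariant _ _ _) 1).hom
    (oneCocycleClass (discreteTopRep (κ.layerSubgroup 0) (geomTorsion W ((p : ℤ) ^ m))) ψ) ∈ _
  rw [map_oneCocycleClass]
  -- the signed Kummer condition at the chosen place above `v`, witnessed by `a` and `k = m`
  refine (mem_localKummerOverOfEmb_iff _ _).mpr ⟨_, a, m, rfl, ?_, fun τ ↦ ?_⟩
  · -- `p^m • a ∈ E(K_v) = E(K_0·K_v) ≤ E^ε(K_∞·K_v)`
    apply localLayerPointsOfEmb_zero_le_signedLocalPointsInfty
    rw [mem_localLayerPointsOfEmb_zero_iff]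
    exact hfix
  · -- the cocycle identity on `Gal(K̄_v / K_∞·K_v)`
    exact ha' (τ : absoluteGaloisGroup (v.adicCompletion K))

end Easy

/-! ## Part 2. The global Lemma 3.7 from the local identity; sign-independence -/

section Facts

variable (W : WeierstrassCurve ℚ) [W.IsGloballyMinimal] (K : Type) [Field K] [NumberField K]
  (p : ℕ) [Fact p.Prime] (κ : ZpExtension K p) (𝔭 𝔭' : HeightOneSpectrum (𝓞 K))

/-- **The global Lemma 3.7 from the local identity**: Hatley–Lei–Vigni's `Sel^±_{p^m}(E/K) =
Sel_{p^m}(E/K)` (the tree's `hatleyLeiVigni2022_lemma37_signedSelmerTorsion_zero`) FOLLOWS from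
`hatleyLeiVigni2022_lemma37_local_signedCondition_eq_kummer`: the signed group `selmerTorsion …
(fun _ ↦ sgn ε) 0 m` and the classical `selmerTorsionOver (κ.layerSubgroup 0) (p^m)` impose the same
conditions away from `p` (`awayTorsionOver` = the `v ∤ p` and archimedean components of
`selmerTorsionOver`) and, by the local identity, the same conditions above `p` — verbatim the printed
reduction "In light of Remark 3.1, it suffices to show that `ℋ^±_{0,v}[p^m]` coincides with the image
of `E(K_v)/p^m E(K_v)`". [cite: HatleyLeiVigni2022, Lemma 3.7 (proof)] -/
theorem lemma37_signedSelmerTorsion_zero_of_local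
    (h : hatleyLeiVigni2022_lemma37_local_signedCondition_eq_kummer W K p κ 𝔭 𝔭') :
    hatleyLeiVigni2022_lemma37_signedSelmerTorsion_zero W K p κ 𝔭 𝔭' := by
  intro hS N hN hH ε m
  ext c
  rw [mem_selmerTorsion_iff, mem_awayTorsionOver_iff]
  simp only [WeierstrassCurve.selmerTorsionOver, AddSubgroup.mem_inf, AddSubgroup.mem_iInf,
    AddSubgroup.mem_comap, AddMonoidHom.mem_ker]
  constructor
  · rintro ⟨⟨hfin, hinf⟩, habove⟩
    refine ⟨fun v σ ↦ ?_, hinf⟩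
    by_cases hv : ((p : ℕ) : 𝓞 K) ∈ v.asIdeal
    · have hc := habove v hv
      rw [h hS N hN hH v hv ε m] at hc
      simpa only [AddSubgroup.mem_iInf, AddSubgroup.mem_comap, AddMonoidHom.mem_ker] using
        (AddSubgroup.mem_iInf.mp hc) σ
    · exact hfin v hv σ
  · rintro ⟨hfin, hinf⟩
    refine ⟨⟨fun v _ σ ↦ hfin v σ, hinf⟩, fun v hv ↦ ?_⟩
    rw [h hS N hN hH v hv ε m]
    exact AddSubgroup.mem_iInf.mpr fun σ ↦ by
      simpa only [AddSubgroup.mem_comap, AddMonoidHom.mem_ker] using hfin v σ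

/-- Under the local identity the layer-`0` signed condition does not depend on the sign:
`condAboveTorsion … (sgn ε) 0 m = condAboveTorsion … (sgn ε') 0 m` (both are the Kummer condition;
HLV: "`Sel^+_{p^m}(E/K) = Sel^-_{p^m}(E/K) = Sel_{p^m}(E/K)`"). [cite: HatleyLeiVigni2022, Lemma 3.7] -/
theorem condAboveTorsion_sgn_zero_eq_of_local
    (h : hatleyLeiVigni2022_lemma37_local_signedCondition_eq_kummer W K p κ 𝔭 𝔭')
    (hS : Setting W K p κ 𝔭 𝔭') {N : ℕ} (hN : (W.conductorNorm ℤ : ℕ) = N)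
    (hH : SatisfiesHeegnerHypothesis N K) {v : HeightOneSpectrum (𝓞 K)}
    (hv : ((p : ℕ) : 𝓞 K) ∈ v.asIdeal) (ε ε' : ℤˣ) (m : ℕ) :
    condAboveTorsion (W.baseChange K) p κ v (.sgn ε) 0 m =
      condAboveTorsion (W.baseChange K) p κ v (.sgn ε') 0 m := by
  rw [h hS N hN hH v hv ε m, h hS N hN hH v hv ε' m]

end Facts

end Literature.NumberTheory.EllipticCurves.AcSigned

end
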